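import Summits.RiemannHypothesis.RiemannHypothesis.Theorems.GroundBartaEvenWinsBeyondArchDeflationWindowGlue
import HarnessLib

/-!
# RiemannHypothesis / GroundBarta — rung 4 (`EvenWinsBeyondArch`, stmt-RiemannHypothesis-18807 / 18085):
# the deflated Temple L-side beyond `(log 5)/2`, XVIII c (four slots) — the window glue with FOUR prime slots

Helper file (`--supports stmt-RiemannHypothesis-18807`), RH-free, Mathlib + landed tree files only, no facts.  rh-explicit seat
weil-5 (lead ruling R3-8a, 2026-08-22), four-slot twin of prover B's …DeflationWindowGlue (file XVIII c).  On the `{2,3,4,5}`-window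
(`(log 5)/2 < c ≤ (log 7)/2`; cells `c = 83/100`, `97/100`) the prime sum of a window image has four slots (`dt_hprimes_four`,
…DeflationWindowConst4, prover A g12), so the explicit real residual of the `i`-th trial vector is

  `R_i(y) = 2P_c cosh(y/2) − 2P_s sinh(y/2) + Σ_{j≤4} w_j (2g_i(y) − ĝ_i(y−L_j) − ĝ_i(y+L_j)) + [arch split] + g_i(y)(Ψ(c−y)+Ψ(c+y))
            − M̃ g_i(y) − Σ_l W̃_il g_l(y)`

(`dt_windowResidual4`).  The three theorems are B's with the four-slot `hprimes` hypothesis — the underlying residual identity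
(`dt_residual_real_shift`), integrability (`dt_residual_sq_intervalIntegrable`) and panel glue (`dt_residual_normSq_le_of_panels`)
are slot-agnostic: `dt_residual_eq_windowResidual4`, `dt_windowResidual4_sq_intervalIntegrable`, `dt_residual_normSq_le_of_panelBounds4`
(`∫‖F_i − Σ_l W_il v_l‖² ≤ 2 Σ_{k<m} q_k` from per-panel bounds of `R_i`).  Remark for generators: the `2w₄ g_i(y)` part of the new
slot is a multiple of `v_i` on the window and can be absorbed into `W̃_ii` (W is free); only `−w₄ ĝ_i(y − log 5)` on
`[log 5 − c, c)` is genuinely new (`y + log 5 > c` always).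

References: E. Bombieri, Rend. Mat. Acc. Lincei (9) 11 (2000) Thm 2 [Bombieri2000Weil]; Goerisch–Haunhorst (1985) [GoerischHaunhorst1985].
-/

set_option linter.dupNamespace false

noncomputable section

open MeasureTheory Set Filter Finset
open scoped Topology BigOperators

namespace Summit.RiemannHypothesis.RiemannHypothesis.Theorems.EvenWinsBeyondArch

open Literature.NumberTheory.LFunctions
open Literature.Analysis.ValidatedNumerics.ExpPoly

section Window4

variable {c : ℝ} {k : ℕ} {gp : Fin k → Poly} {v F : Fin k → ℝ → ℂ}

/-- The explicit real residual of the `i`-th vector with FOUR prime slots and the rational stand-ins `M̃`, `W̃` (a function of `y`). -/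
def dt_windowResidual4 (c : ℝ) (gp : Fin k → Poly) (w1 L1 w2 L2 w3 L3 w4 L4 Mt : ℝ) (Wt : Fin k → Fin k → ℝ) (i : Fin k)
    (y : ℝ) : ℝ :=
  (2 * (∫ x in (-c)..c, Poly.eval (gp i) x * Real.cosh (x / 2)) * Real.cosh (y / 2) -
      2 * (∫ x in (-c)..c, Poly.eval (gp i) x * Real.sinh (x / 2)) * Real.sinh (y / 2)) +
    (w1 * (2 * Poly.eval (gp i) y - (Icc (-c) c).indicator (fun x ↦ Poly.eval (gp i) x) (y - L1) -
        (Icc (-c) c).indicator (fun x ↦ Poly.eval (gp i) x) (y + L1)) +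
      w2 * (2 * Poly.eval (gp i) y - (Icc (-c) c).indicator (fun x ↦ Poly.eval (gp i) x) (y - L2) -
        (Icc (-c) c).indicator (fun x ↦ Poly.eval (gp i) x) (y + L2)) +
      w3 * (2 * Poly.eval (gp i) y - (Icc (-c) c).indicator (fun x ↦ Poly.eval (gp i) x) (y - L3) -
        (Icc (-c) c).indicator (fun x ↦ Poly.eval (gp i) x) (y + L3)) +
      w4 * (2 * Poly.eval (gp i) y - (Icc (-c) c).indicator (fun x ↦ Poly.eval (gp i) x) (y - L4) -
        (Icc (-c) c).indicator (fun x ↦ Poly.eval (gp i) x) (y + L4))) +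
    ((∫ t in Ioc 0 (c - y), weilArchDensityG t *
        ((2 * Poly.eval (gp i) y - Poly.eval (gp i) (y - t) - Poly.eval (gp i) (y + t)) / t)) +
      ∫ t in Ioc (c - y) (c + y), weilArchDensityG t * ((Poly.eval (gp i) y - Poly.eval (gp i) (y - t)) / t)) +
    Poly.eval (gp i) y * (weilArchTail (c - y) + weilArchTail (c + y)) -
    Mt * Poly.eval (gp i) y - ∑ l, Wt i l * Poly.eval (gp l) y

/-- **The residual of file XV is the explicit real residual** (on `[0, c)`), for `W = W̃ + [l=i](M̃ − M_c)`, given the four-slot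
form of the prime sum (`dt_hprimes_four`, `(log 5)/2 < c ≤ (log 7)/2`). [cite: Bombieri2000Weil, Thm 2] -/
theorem dt_residual_eq_windowResidual4 (hc : 0 < c)
    (hv : ∀ i x, v i x = (((Icc (-c) c).indicator (fun x ↦ Poly.eval (gp i) x) x : ℝ) : ℂ))
    (hF : ∀ i y, F i y = (Icc (-c) c).indicator (fun y ↦
        2 * (∫ x, v i x * (Real.cosh (x / 2) : ℂ)) * (Real.cosh (y / 2) : ℂ) -
          2 * (∫ x, v i x * (Real.sinh (x / 2) : ℂ)) * (Real.sinh (y / 2) : ℂ) +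
        (∑ n ∈ weilPrimeIndex c, (((ArithmeticFunction.vonMangoldt n : ℝ) / Real.sqrt n : ℝ) : ℂ) *
          (2 * v i y - v i (y - Real.log n) - v i (y + Real.log n))) +
        ∫ t in Ioi 0, (weilArchDensity t : ℂ) * (2 * v i y - v i (y - t) - v i (y + t))) y -
      (weilMarkovConstant c : ℂ) * v i y)
    {w1 L1 w2 L2 w3 L3 w4 L4 : ℝ} (Mt : ℝ) (Wt : Fin k → Fin k → ℝ) (i : Fin k)
    (hprimes : ∀ y : ℝ, ∑ n ∈ weilPrimeIndex c, ((ArithmeticFunction.vonMangoldt n : ℝ) / Real.sqrt n) *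
        (2 * Poly.eval (gp i) y - (Icc (-c) c).indicator (fun x ↦ Poly.eval (gp i) x) (y - Real.log n) -
          (Icc (-c) c).indicator (fun x ↦ Poly.eval (gp i) x) (y + Real.log n)) =
      w1 * (2 * Poly.eval (gp i) y - (Icc (-c) c).indicator (fun x ↦ Poly.eval (gp i) x) (y - L1) -
          (Icc (-c) c).indicator (fun x ↦ Poly.eval (gp i) x) (y + L1)) +
        w2 * (2 * Poly.eval (gp i) y - (Icc (-c) c).indicator (fun x ↦ Poly.eval (gp i) x) (y - L2) -
          (Icc (-c) c).indicator (fun x ↦ Poly.eval (gp i) x) (y + L2)) +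
        w3 * (2 * Poly.eval (gp i) y - (Icc (-c) c).indicator (fun x ↦ Poly.eval (gp i) x) (y - L3) -
          (Icc (-c) c).indicator (fun x ↦ Poly.eval (gp i) x) (y + L3)) +
        w4 * (2 * Poly.eval (gp i) y - (Icc (-c) c).indicator (fun x ↦ Poly.eval (gp i) x) (y - L4) -
          (Icc (-c) c).indicator (fun x ↦ Poly.eval (gp i) x) (y + L4)))
    {y : ℝ} (hy : y ∈ Ico 0 c) :
    (F i - ∑ l, (Wt i l + if l = i then Mt - weilMarkovConstant c else 0) • v l) y =
      (dt_windowResidual4 c gp w1 L1 w2 L2 w3 L3 w4 L4 Mt Wt i y : ℂ) := by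
  rw [dt_residual_real_shift hc (g := fun l x ↦ Poly.eval (gp l) x) (fun l ↦ dt_contDiff_polyEval (gp l)) hv hF Wt Mt i hy,
    dt_windowResidual4, ← hprimes y]
  simp only [weilArchTail]
  congr 1
  ring

/-- **Integrability side condition**: on every panel, `ρ ↦ R_i(y_k + ρ)²` is interval integrable. -/
theorem dt_windowResidual4_sq_intervalIntegrable (hc : 0 < c)
    (hv : ∀ i x, v i x = (((Icc (-c) c).indicator (fun x ↦ Poly.eval (gp i) x) x : ℝ) : ℂ))
    (hF : ∀ i y, F i y = (Icc (-c) c).indicator (fun y ↦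
        2 * (∫ x, v i x * (Real.cosh (x / 2) : ℂ)) * (Real.cosh (y / 2) : ℂ) -
          2 * (∫ x, v i x * (Real.sinh (x / 2) : ℂ)) * (Real.sinh (y / 2) : ℂ) +
        (∑ n ∈ weilPrimeIndex c, (((ArithmeticFunction.vonMangoldt n : ℝ) / Real.sqrt n : ℝ) : ℂ) *
          (2 * v i y - v i (y - Real.log n) - v i (y + Real.log n))) +
        ∫ t in Ioi 0, (weilArchDensity t : ℂ) * (2 * v i y - v i (y - t) - v i (y + t))) y -
      (weilMarkovConstant c : ℂ) * v i y)
    {w1 L1 w2 L2 w3 L3 w4 L4 : ℝ} (Mt : ℝ) (Wt : Fin k → Fin k → ℝ) (i : Fin k)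
    (hprimes : ∀ y : ℝ, ∑ n ∈ weilPrimeIndex c, ((ArithmeticFunction.vonMangoldt n : ℝ) / Real.sqrt n) *
        (2 * Poly.eval (gp i) y - (Icc (-c) c).indicator (fun x ↦ Poly.eval (gp i) x) (y - Real.log n) -
          (Icc (-c) c).indicator (fun x ↦ Poly.eval (gp i) x) (y + Real.log n)) =
      w1 * (2 * Poly.eval (gp i) y - (Icc (-c) c).indicator (fun x ↦ Poly.eval (gp i) x) (y - L1) -
          (Icc (-c) c).indicator (fun x ↦ Poly.eval (gp i) x) (y + L1)) +
        w2 * (2 * Poly.eval (gp i) y - (Icc (-c) c).indicator (fun x ↦ Poly.eval (gp i) x) (y - L2) -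
          (Icc (-c) c).indicator (fun x ↦ Poly.eval (gp i) x) (y + L2)) +
        w3 * (2 * Poly.eval (gp i) y - (Icc (-c) c).indicator (fun x ↦ Poly.eval (gp i) x) (y - L3) -
          (Icc (-c) c).indicator (fun x ↦ Poly.eval (gp i) x) (y + L3)) +
        w4 * (2 * Poly.eval (gp i) y - (Icc (-c) c).indicator (fun x ↦ Poly.eval (gp i) x) (y - L4) -
          (Icc (-c) c).indicator (fun x ↦ Poly.eval (gp i) x) (y + L4)))
    {m : ℕ} (hm : 0 < m) {j : ℕ} (hjm : j < m) :
    IntervalIntegrable (fun ρ ↦ dt_windowResidual4 c gp w1 L1 w2 L2 w3 L3 w4 L4 Mt Wt i ((2 * j + 1) * (c / (2 * m)) + ρ) ^ 2) volume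
      (-(c / (2 * m))) (c / (2 * m)) :=
  dt_residual_sq_intervalIntegrable hc (fun l x ↦ Poly.eval (gp l) x) (fun l ↦ dt_contDiff_polyEval (gp l)) v F hv hF
    (fun i l ↦ Wt i l + if l = i then Mt - weilMarkovConstant c else 0) i hm _
    (fun _ hy ↦ dt_residual_eq_windowResidual4 hc hv hF Mt Wt i hprimes hy) hjm

/-- **The window glue**: per-panel bounds of the explicit real residual give the residual norm bound `hs` of the sigma criterion,
with the true coefficient matrix `W = W̃ + [l=i](M̃ − M_c)` (which never has to be evaluated).
[cite: GoerischHaunhorst1985, §2] [cite: Bombieri2000Weil, Thm 2] -/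
theorem dt_residual_normSq_le_of_panelBounds4 (hc : 0 < c) {σ : ℝ} (hσ : σ = 1 ∨ σ = -1)
    (hgp : ∀ i x, Poly.eval (gp i) (-x) = σ * Poly.eval (gp i) x)
    (hv : ∀ i x, v i x = (((Icc (-c) c).indicator (fun x ↦ Poly.eval (gp i) x) x : ℝ) : ℂ))
    (hF : ∀ i y, F i y = (Icc (-c) c).indicator (fun y ↦
        2 * (∫ x, v i x * (Real.cosh (x / 2) : ℂ)) * (Real.cosh (y / 2) : ℂ) -
          2 * (∫ x, v i x * (Real.sinh (x / 2) : ℂ)) * (Real.sinh (y / 2) : ℂ) +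
        (∑ n ∈ weilPrimeIndex c, (((ArithmeticFunction.vonMangoldt n : ℝ) / Real.sqrt n : ℝ) : ℂ) *
          (2 * v i y - v i (y - Real.log n) - v i (y + Real.log n))) +
        ∫ t in Ioi 0, (weilArchDensity t : ℂ) * (2 * v i y - v i (y - t) - v i (y + t))) y -
      (weilMarkovConstant c : ℂ) * v i y)
    {w1 L1 w2 L2 w3 L3 w4 L4 : ℝ} (Mt : ℝ) (Wt : Fin k → Fin k → ℝ) (i : Fin k)
    (hprimes : ∀ y : ℝ, ∑ n ∈ weilPrimeIndex c, ((ArithmeticFunction.vonMangoldt n : ℝ) / Real.sqrt n) *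
        (2 * Poly.eval (gp i) y - (Icc (-c) c).indicator (fun x ↦ Poly.eval (gp i) x) (y - Real.log n) -
          (Icc (-c) c).indicator (fun x ↦ Poly.eval (gp i) x) (y + Real.log n)) =
      w1 * (2 * Poly.eval (gp i) y - (Icc (-c) c).indicator (fun x ↦ Poly.eval (gp i) x) (y - L1) -
          (Icc (-c) c).indicator (fun x ↦ Poly.eval (gp i) x) (y + L1)) +
        w2 * (2 * Poly.eval (gp i) y - (Icc (-c) c).indicator (fun x ↦ Poly.eval (gp i) x) (y - L2) -
          (Icc (-c) c).indicator (fun x ↦ Poly.eval (gp i) x) (y + L2)) +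
        w3 * (2 * Poly.eval (gp i) y - (Icc (-c) c).indicator (fun x ↦ Poly.eval (gp i) x) (y - L3) -
          (Icc (-c) c).indicator (fun x ↦ Poly.eval (gp i) x) (y + L3)) +
        w4 * (2 * Poly.eval (gp i) y - (Icc (-c) c).indicator (fun x ↦ Poly.eval (gp i) x) (y - L4) -
          (Icc (-c) c).indicator (fun x ↦ Poly.eval (gp i) x) (y + L4)))
    {m : ℕ} (hm : 0 < m) (q : ℕ → ℝ)
    (hq : ∀ j, j < m → ∫ ρ in (-(c / (2 * m)))..(c / (2 * m)),
      dt_windowResidual4 c gp w1 L1 w2 L2 w3 L3 w4 L4 Mt Wt i ((2 * j + 1) * (c / (2 * m)) + ρ) ^ 2 ≤ q j) :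
    ∫ y, ‖(F i - ∑ l, (Wt i l + if l = i then Mt - weilMarkovConstant c else 0) • v l) y‖ ^ 2 ≤
      2 * ∑ j ∈ Finset.range m, q j :=
  dt_residual_normSq_le_of_panels hc hσ (fun l x ↦ Poly.eval (gp l) x) (fun l ↦ dt_contDiff_polyEval (gp l)) hgp v F hv hF
    (fun i l ↦ Wt i l + if l = i then Mt - weilMarkovConstant c else 0) i hm _
    (fun _ hy ↦ dt_residual_eq_windowResidual4 hc hv hF Mt Wt i hprimes hy) q hq

end Window4

end Summit.RiemannHypothesis.RiemannHypothesis.Theorems.EvenWinsBeyondArch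

end
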